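import Summits.NavierStokesRegularity.FunctionalMining.StrainMomentRegBalance
import HarnessLib

/-!
# FunctionalMining — NOGO N8 for EVERY real `q > 1`: `StrainMomentCZClosure` holds on `T³`

Search for candidate a priori estimates; no regularity claim. Cell `pub-nsfunc`, prove seat (gen 13). Third of three
files. The dictionary's typed node `StrainMomentCZClosure` (`StrainMoment.lean`: "for every
`1 < q < ∞` there is `C = C(q)` with `StrainMomentRateSupBound q C`", NOGO N8 = K0-FLAGS A5, filed
`@[conjecture]` "until its `L^q` inputs are tree facts") is PROVED here at `d = Fin 3`:
**`StrainMoment.strainMomentCZClosure_holds : StrainMomentCZClosure (d := Fin 3)`**, through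
**`rateSupBound_of_one_lt (hq : 1 < q) : ∃ C ≥ 0, StrainMomentRateSupBound (d := Fin 3) q C`**.

The rows are in MAJORANT form ("every one-sided derivative value `R` of `s ↦ ∫|S(u s)|^q` within
`[a, b]` at `t` satisfies `R ≤ C M ∫|S(u t)|^q` when `|ω(t,·)|² ≤ M²`"); no balance for `∫|S|^q`
itself is used. Steps (regularised moments `F_ε = ∫(|S|²+ε)^{q/2}`, previous two files):

1. (localisation) by the tube lemma over the compact torus (tree `eventually_norm_sub_lt`) the
   majorant `M` at time `t` relaxes to `M + δ` on a window `J = [a', b'] ∋ t`, `J ∈ 𝓝[[a,b]] t`;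
2. (`Ḟ_ε ≤ K F_ε` on `J`, `K = C(M+δ)`; `reg_hasDerivWithinAt_le` for the solution restricted to `J`)
   hence `e^{−Kτ}F_ε(τ)` is antitone on `J` (`exp_bound_of_deriv_le`, monotonicity form of
   Grönwall): `F_ε(s) ≤ e^{K(s−t)}F_ε(t)` for `s ≥ t`, `F_ε(t) ≤ e^{K(t−s)}F_ε(s)` for `s ≤ t`;
3. (`ε → 0⁺`) the same two inequalities for `F = ∫|S|^q` (continuity of the parametric integral,
   `continuous_integral_add_rpow`, `le_of_forall_pos_le_of_continuousAt`);
4. (slopes, `le_of_exp_bounds`) `slope F t ≤ slope (F(t)e^{K(·−t)}) t` on the side of `t` inside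
   `[a, b]`, so `R ≤ K F(t)`; finally `δ → 0⁺`.

Corollaries: `functionalRateSupBound_of_one_lt` (generic shape), all log rows `logBudget_of_one_lt`
(A5 domination `strainMomentLogBudget_of_rateSupBound`), the singular-weight matrix row `q = 3/2`
(`rateSupBound_three_halves`, `logBudget_three_halves`). Existential constants; CONTROL rows
(closing them needs `∫‖ω‖_∞ dt < ∞`, Beale–Kato–Majda); the value is the kernel check of N8 on its
whole stated range `1 < q < ∞`.
-/

noncomputable section

open MeasureTheory Finset Set Filter Topology
open scoped InnerProductSpace RealInnerProductSpace ContDiff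

namespace Summit.NavierStokesRegularity.FunctionalMining

open Literature.Analysis.FunctionSpaces Literature.Analysis.FunctionSpaces.Torus
  Literature.Analysis.FluidPDE

namespace StrainMoment

open StrainL4 VorticityL4

/-! ## 5. Three real-variable lemmas: exponential bounds, `ε → 0⁺`, and slopes -/

/-- **Grönwall by monotonicity.** If `f` has at every point of `[a, b]` (`a < b`) a one-sided
derivative `D` within `[a, b]` with `D ≤ K f`, then `e^{−Kτ} f(τ)` is antitone on `[a, b]`, i.e.
`f t ≤ e^{K(t−s)} f s` for `s ≤ t` in `[a, b]`. [folklore] -/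
theorem exp_bound_of_deriv_le {f : ℝ → ℝ} {a b K : ℝ} (hab : a < b)
    (hf : ∀ τ ∈ Icc a b, ∃ D : ℝ, HasDerivWithinAt f D (Icc a b) τ ∧ D ≤ K * f τ)
    {s t : ℝ} (hs : s ∈ Icc a b) (ht : t ∈ Icc a b) (hst : s ≤ t) :
    f t ≤ Real.exp (K * (t - s)) * f s := by
  set g : ℝ → ℝ := fun τ => Real.exp (-K * τ) * f τ with hg
  set g' : ℝ → ℝ := fun τ => Real.exp (-K * τ) * (-K) * f τ +
    Real.exp (-K * τ) * derivWithin f (Icc a b) τ with hg'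
  have hU : UniqueDiffOn ℝ (Icc a b) := uniqueDiffOn_Icc hab
  have hder : ∀ τ ∈ Icc a b, HasDerivWithinAt g (g' τ) (Icc a b) τ ∧ g' τ ≤ 0 := by
    intro τ hτ
    obtain ⟨D, hD, hle⟩ := hf τ hτ
    have hDW : derivWithin f (Icc a b) τ = D := hD.derivWithin (hU τ hτ)
    have h1 : HasDerivAt (fun τ : ℝ => -K * τ) (-K) τ := by
      simpa using (hasDerivAt_id τ).const_mul (-K)
    have he : HasDerivWithinAt (fun τ : ℝ => Real.exp (-K * τ)) (Real.exp (-K * τ) * (-K))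
        (Icc a b) τ := h1.exp.hasDerivWithinAt
    refine ⟨?_, ?_⟩
    · have h := he.mul hD
      show HasDerivWithinAt g (Real.exp (-K * τ) * (-K) * f τ +
        Real.exp (-K * τ) * derivWithin f (Icc a b) τ) (Icc a b) τ
      rw [hDW]
      exact h
    · show Real.exp (-K * τ) * (-K) * f τ + Real.exp (-K * τ) * derivWithin f (Icc a b) τ ≤ 0
      rw [hDW]
      have hexp : 0 < Real.exp (-K * τ) := Real.exp_pos _
      have : Real.exp (-K * τ) * (-K) * f τ + Real.exp (-K * τ) * D =
          Real.exp (-K * τ) * (D - K * f τ) := by ring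
      rw [this]
      exact mul_nonpos_of_nonneg_of_nonpos hexp.le (by linarith)
  have hanti : AntitoneOn g (Icc a b) :=
    antitoneOn_of_hasDerivWithinAt_nonpos (convex_Icc a b)
      (fun τ hτ => (hder τ hτ).1.continuousWithinAt)
      (fun τ hτ => ((hder τ (interior_subset hτ)).1).mono interior_subset)
      fun τ hτ => (hder τ (interior_subset hτ)).2
  have h := hanti hs ht hst
  -- `e^{-Kt} f t ≤ e^{-Ks} f s` ⇒ `f t ≤ e^{K(t-s)} f s`
  simp only [hg] at h
  have hexp : 0 < Real.exp (K * t) := Real.exp_pos _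
  have e1 : f t = Real.exp (K * t) * (Real.exp (-K * t) * f t) := by
    rw [← mul_assoc, ← Real.exp_add, show K * t + -K * t = 0 by ring, Real.exp_zero, one_mul]
  have e2 : Real.exp (K * t) * (Real.exp (-K * s) * f s) = Real.exp (K * (t - s)) * f s := by
    rw [← mul_assoc, ← Real.exp_add]; congr 1; congr 1; ring
  rw [e1, ← e2]
  exact mul_le_mul_of_nonneg_left h hexp.le

/-- Passing to `ε → 0⁺` in an inequality between functions continuous at `0`. [folklore] -/
theorem le_of_forall_pos_le_of_continuousAt {A B : ℝ → ℝ} (hA : ContinuousAt A 0)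
    (hB : ContinuousAt B 0) (h : ∀ ε : ℝ, 0 < ε → ε ≤ 1 → A ε ≤ B ε) : A 0 ≤ B 0 := by
  have hφ : ContinuousAt (fun ε => B ε - A ε) 0 := hB.sub hA
  have ht : Tendsto (fun ε => B ε - A ε) (𝓝[>] 0) (𝓝 (B 0 - A 0)) :=
    hφ.tendsto.mono_left nhdsWithin_le_nhds
  have hmem : Ioo (0 : ℝ) 1 ∈ 𝓝[>] (0 : ℝ) := Ioo_mem_nhdsGT one_pos
  have h0 : 0 ≤ B 0 - A 0 := by
    refine ge_of_tendsto ht ?_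
    filter_upwards [hmem] with ε hε using by linarith [h ε hε.1 hε.2.le]
  linarith

/-- Continuity in `ε` of the regularised moment `ε ↦ ∫ (Q x + ε)^r` (`Q` continuous, `r ≥ 0`).
[folklore] -/
theorem continuous_integral_add_rpow {d : Type*} [Fintype d] {Q : UnitAddTorus d → ℝ}
    (hQ : Continuous Q) {r : ℝ} (hr : 0 ≤ r) : Continuous fun ε : ℝ => ∫ x, (Q x + ε) ^ r := by
  have hF : Continuous (Function.uncurry fun (ε : ℝ) (x : UnitAddTorus d) => (Q x + ε) ^ r) :=
    ((hQ.comp continuous_snd).add continuous_fst).rpow_const fun _ => Or.inr hr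
  have h := continuous_parametric_integral_of_continuous (μ := volume) hF isCompact_univ
  simpa only [Measure.restrict_univ] using h

/-- **Slopes.** Let `f` have the one-sided derivative value `R` within `[a, b]` (`a < b`) at
`t ∈ [a, b]`, and on some `J ∈ 𝓝[[a,b]] t` let `f s ≤ e^{K(s−t)} f t` for `s ≥ t` and
`f t ≤ e^{K(t−s)} f s` for `s ≤ t`. Then `R ≤ K f t` (`slope f t ≤ slope (f(t)e^{K(·−t)}) t` on the
side of `t` that `[a, b]` contains). [folklore] -/
theorem le_of_exp_bounds {f : ℝ → ℝ} {a b t R K : ℝ} {J : Set ℝ} (hab : a < b) (ht : t ∈ Icc a b)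
    (hR : HasDerivWithinAt f R (Icc a b) t) (hJ : J ∈ 𝓝[Icc a b] t)
    (hup : ∀ s ∈ J, t ≤ s → f s ≤ Real.exp (K * (s - t)) * f t)
    (hdown : ∀ s ∈ J, s ≤ t → f t ≤ Real.exp (K * (t - s)) * f s) : R ≤ K * f t := by
  -- the comparison function and its slope limit
  set Φ : ℝ → ℝ := fun s => Real.exp (K * (s - t)) * f t with hΦ
  have hΦd : HasDerivAt Φ (K * f t) t := by
    have h1 : HasDerivAt (fun s : ℝ => K * (s - t)) K t := by
      simpa using ((hasDerivAt_id t).sub_const t).const_mul K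
    have h2 := h1.exp.mul_const (f t)
    simp only [sub_self, mul_zero, Real.exp_zero, one_mul] at h2
    exact h2
  have hΦt : Φ t = f t := by simp [hΦ]
  have hΦs : Tendsto (slope Φ t) (𝓝[≠] t) (𝓝 (K * f t)) := hasDerivAt_iff_tendsto_slope.1 hΦd
  have hfs : Tendsto (slope f t) (𝓝[Icc a b \ {t}] t) (𝓝 R) :=
    hasDerivWithinAt_iff_tendsto_slope.1 hR
  -- pointwise comparison of slopes on `J \ {t}`
  have hcmp : ∀ s ∈ J, s ≠ t → slope f t s ≤ slope Φ t s := by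
    intro s hsJ hst
    rw [slope_def_field, slope_def_field, hΦt]
    rcases lt_or_gt_of_ne hst with hlt | hgt
    · -- `s < t`: `Φ s ≤ f s`, divide by `s - t < 0`
      have h1 := hdown s hsJ hlt.le
      have hpos : 0 < Real.exp (K * (s - t)) := Real.exp_pos _
      have h2 : Φ s ≤ f s := by
        show Real.exp (K * (s - t)) * f t ≤ f s
        have h3 := mul_le_mul_of_nonneg_left h1 hpos.le
        have e : Real.exp (K * (s - t)) * (Real.exp (K * (t - s)) * f s) = f s := by
          rw [← mul_assoc, ← Real.exp_add, show K * (s - t) + K * (t - s) = 0 by ring,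
            Real.exp_zero, one_mul]
        rw [e] at h3
        exact h3
      exact div_le_div_of_nonpos_of_le (by linarith) (by linarith)
    · -- `t < s`: `f s ≤ Φ s`, divide by `s - t > 0`
      have h1 := hup s hsJ hgt.le
      exact div_le_div_of_nonneg_right (by show f s - f t ≤ Φ s - f t; linarith) (by linarith)
  -- the side of `t` inside `[a, b]`
  rcases lt_or_eq_of_le ht.2 with htb | htb
  · -- `t < b`: work on `(t, b]`
    have hsub : Ioc t b ⊆ Icc a b \ {t} := fun s hs =>
      ⟨⟨le_trans ht.1 hs.1.le, hs.2⟩, fun h => by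
        have : s = t := h
        rw [this] at hs; exact lt_irrefl t hs.1⟩
    have hsub' : Ioc t b ⊆ {t}ᶜ := fun s hs => (hsub hs).2
    haveI : (𝓝[Ioc t b] t).NeBot := left_nhdsWithin_Ioc_neBot htb
    have hf' := hfs.mono_left (nhdsWithin_mono t hsub)
    have hΦ' := hΦs.mono_left (nhdsWithin_mono t hsub')
    have hJ' : J ∈ 𝓝[Ioc t b] t := nhdsWithin_mono t (fun s hs => (hsub hs).1) hJ
    refine le_of_tendsto_of_tendsto hf' hΦ' ?_
    filter_upwards [hJ', self_mem_nhdsWithin] with s hsJ hs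
    exact hcmp s hsJ (fun h => (hsub hs).2 h)
  · -- `t = b`: work on `[a, t)`
    have hat : a < t := by rw [htb]; exact hab
    have hsub : Ico a t ⊆ Icc a b \ {t} := fun s hs =>
      ⟨⟨hs.1, by rw [← htb]; exact hs.2.le⟩, fun h => by
        have : s = t := h
        rw [this] at hs; exact lt_irrefl t hs.2⟩
    have hsub' : Ico a t ⊆ {t}ᶜ := fun s hs => (hsub hs).2
    haveI : (𝓝[Ico a t] t).NeBot := right_nhdsWithin_Ico_neBot hat
    have hf' := hfs.mono_left (nhdsWithin_mono t hsub)
    have hΦ' := hΦs.mono_left (nhdsWithin_mono t hsub')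
    have hJ' : J ∈ 𝓝[Ico a t] t := nhdsWithin_mono t (fun s hs => (hsub hs).1) hJ
    refine le_of_tendsto_of_tendsto hf' hΦ' ?_
    filter_upwards [hJ', self_mem_nhdsWithin] with s hsJ hs
    exact hcmp s hsJ (fun h => (hsub hs).2 h)

/-! ## 6. N8 for every real `q > 1`; `StrainMomentCZClosure` -/

/-- **NOGO N8 (K0-FLAGS A5) in the kernel for EVERY real `q > 1`.** There is `C ≥ 0` with
`StrainMomentRateSupBound q C` on `T³ = UnitAddTorus (Fin 3)`: along every classical solution of
unforced Navier–Stokes/Euler (`ν ≥ 0`) on `[a, b]`, at every time `t` and for every pointwise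
vorticity majorant `M ≥ 0` (`|ω(t,x)|² ≤ M²`), every one-sided derivative value `R` of
`s ↦ ∫|S(u s)|^q` within `[a, b]` at `t` satisfies `R ≤ C · M · ∫|S(u t)|^q`;
`C = q (K₃^{1/q} + (9^q C_P K₃)^{1/q})` (existential Calderón–Zygmund constants). Proof by the
regularised moments `∫(|S|²+ε)^{q/2}` (module docstring, steps 1–6). CONTROL rows: closing them
needs `∫‖ω‖_∞ dt < ∞` (Beale–Kato–Majda). [ours; NOGO.md N8 with tree inputs] -/
theorem rateSupBound_of_one_lt {q : ℝ} (hq : 1 < q) :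
    ∃ C : ℝ, 0 ≤ C ∧ StrainMomentRateSupBound (d := Fin 3) q C := by
  obtain ⟨K₃, hK₃0, hK₃⟩ := exists_gradMoment_le_sup_mul_of_one_lt hq
  obtain ⟨CP, hCP0, hCP⟩ := exists_hess_rpow (d := Fin 3) (q := q) hq
  have hq0 : 0 < q := by linarith
  obtain ⟨C, hC⟩ : ∃ C : ℝ, C = q * (K₃ ^ (1 / q) + ((9 : ℝ) ^ q * CP * K₃) ^ (1 / q)) := ⟨_, rfl⟩
  have hC0 : 0 ≤ C := by rw [hC]; positivity
  refine ⟨C, hC0, ?_⟩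
  intro _ ν hν a b hab u p hsol t ht M hM hω R hR
  have hu : IsSmoothSpaceTimeOn (Icc a b) u := hsol.smooth_velocity
  have hF0 : 0 ≤ torusStrainMoment q (u t) := torusStrainMoment_nonneg q (u t)
  -- reduction to `R ≤ C (M + δ) F(t)` for every `δ > 0`
  suffices key : ∀ δ : ℝ, 0 < δ → R ≤ C * (M + δ) * torusStrainMoment q (u t) by
    refine le_of_forall_pos_le_add fun e he => ?_
    have hden : 0 < C * torusStrainMoment q (u t) + 1 := by positivity
    have h := key (e / (C * torusStrainMoment q (u t) + 1)) (div_pos he hden)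
    have h3 : C * torusStrainMoment q (u t) / (C * torusStrainMoment q (u t) + 1) ≤ 1 := by
      rw [div_le_one hden]; linarith
    have h2 : C * (e / (C * torusStrainMoment q (u t) + 1)) * torusStrainMoment q (u t) ≤ e := by
      have e1 : C * (e / (C * torusStrainMoment q (u t) + 1)) * torusStrainMoment q (u t) =
          e * (C * torusStrainMoment q (u t) / (C * torusStrainMoment q (u t) + 1)) := by
        rw [mul_div_assoc', div_mul_eq_mul_div, mul_div_assoc']
        congr 1; ring
      rw [e1]
      calc e * (C * torusStrainMoment q (u t) / (C * torusStrainMoment q (u t) + 1)) ≤ e * 1 :=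
            mul_le_mul_of_nonneg_left h3 he.le
        _ = e := mul_one e
    calc R ≤ C * (M + e / (C * torusStrainMoment q (u t) + 1)) * torusStrainMoment q (u t) := h
      _ = C * M * torusStrainMoment q (u t) +
          C * (e / (C * torusStrainMoment q (u t) + 1)) * torusStrainMoment q (u t) := by ring
      _ ≤ C * M * torusStrainMoment q (u t) + e := by linarith
  intro δ hδ
  -- Step 1: a window `J = [a', b'] ∋ t` on which `|ω|² ≤ (M + δ)²` (tube lemma)
  have hU : UniqueDiffOn ℝ (Icc a b) := uniqueDiffOn_Icc hab
  have hQst : IsSmoothSpaceTimeOn (Icc a b) (fun s y => torusVorticitySqAt (u s) y) := by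
    have h : IsSmoothSpaceTimeOn (Icc a b) (fun s y => ∑ i, ∑ j,
        (partialDeriv i (u s) y j - partialDeriv j (u s) y i) ^ 2) :=
      IsSmoothSpaceTimeOn.sum fun i _ => IsSmoothSpaceTimeOn.sum fun j _ =>
        ContDiffOn.pow (((hu.partialDeriv hU i).apply j).sub ((hu.partialDeriv hU j).apply i)) 2
    have hfun : (fun s y => torusVorticitySqAt (u s) y) = fun s y => (2⁻¹ : ℝ) • ∑ i, ∑ j,
        (partialDeriv i (u s) y j - partialDeriv j (u s) y i) ^ 2 := by
      funext s y; rfl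
    rw [hfun]
    exact h.const_smul (2⁻¹ : ℝ)
  have he0 : 0 < δ * (2 * M + δ) := by positivity
  obtain ⟨η, hη, hηP⟩ := Metric.mem_nhdsWithin_iff.1 (hQst.eventually_norm_sub_lt ht he0)
  obtain ⟨a', ha'⟩ : ∃ a' : ℝ, a' = max a (t - η / 2) := ⟨_, rfl⟩
  obtain ⟨b', hb'⟩ : ∃ b' : ℝ, b' = min b (t + η / 2) := ⟨_, rfl⟩
  have hta' : a' ≤ t := by rw [ha']; exact max_le ht.1 (by linarith)
  have htb' : t ≤ b' := by rw [hb']; exact le_min ht.2 (by linarith)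
  have ha'b' : a' < b' := by
    rcases lt_or_eq_of_le ht.2 with htb | htb
    · have : t < b' := by rw [hb']; exact lt_min htb (by linarith)
      linarith
    · have hat : a < t := by rw [htb]; exact hab
      have : a' < t := by rw [ha']; exact max_lt hat (by linarith)
      linarith
  have hJsub : Icc a' b' ⊆ Icc a b := by
    rw [ha', hb']; exact Icc_subset_Icc (le_max_left _ _) (min_le_left _ _)
  have htJ : t ∈ Icc a' b' := ⟨hta', htb'⟩
  have hJω : ∀ τ ∈ Icc a' b', ∀ x, torusVorticitySqAt (u τ) x ≤ (M + δ) ^ 2 := by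
    intro τ hτ x
    have hdist : dist τ t < η := by
      rw [Real.dist_eq, abs_lt]
      have h1 : t - η / 2 ≤ τ := le_trans (by rw [ha']; exact le_max_right _ _) hτ.1
      have h2 : τ ≤ t + η / 2 := le_trans hτ.2 (by rw [hb']; exact min_le_right _ _)
      constructor <;> linarith
    have h' : ∀ y, ‖torusVorticitySqAt (u τ) y - torusVorticitySqAt (u t) y‖ < δ * (2 * M + δ) :=
      hηP ⟨hdist, hJsub hτ⟩
    have h := h' x
    rw [Real.norm_eq_abs, abs_lt] at h
    have h2 := hω x
    nlinarith [h.2, h2]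
  have hJmem : Icc a' b' ∈ 𝓝[Icc a b] t := by
    have h1 : Icc a b ∩ Metric.ball t (η / 2) ∈ 𝓝[Icc a b] t :=
      inter_mem_nhdsWithin _ (Metric.ball_mem_nhds t (half_pos hη))
    refine mem_of_superset h1 fun s hs => ?_
    have hd : dist s t < η / 2 := hs.2
    rw [Real.dist_eq, abs_lt] at hd
    rw [ha', hb']
    exact ⟨max_le hs.1.1 (by linarith), le_min hs.1.2 (by linarith)⟩
  -- Step 2: the solution on `J` and `Ḟ_ε ≤ C(M+δ)F_ε` there
  have hsolJ := hsol.mono hJsub (uniqueDiffOn_Icc ha'b')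
  have hMδ : 0 ≤ M + δ := by linarith
  have hreg : ∀ ε : ℝ, 0 < ε → ∀ τ ∈ Icc a' b', ∃ D : ℝ,
      HasDerivWithinAt (fun s => ∫ x, (torusStrainSqAt (u s) x + ε) ^ (q / 2)) D (Icc a' b') τ ∧
        D ≤ C * (M + δ) * ∫ x, (torusStrainSqAt (u τ) x + ε) ^ (q / 2) := by
    intro ε hε τ hτ
    obtain ⟨D, hD, hle⟩ := reg_hasDerivWithinAt_le hq hK₃0 hK₃ hCP0 ha'b' hν hsolJ
      (fun s hs i j => hCP hab hsol s (hJsub hs) i j) hMδ hJω hε hτ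
    refine ⟨D, hD, ?_⟩
    calc D ≤ q * (K₃ ^ (1 / q) + ((9 : ℝ) ^ q * CP * K₃) ^ (1 / q)) * (M + δ) *
        ∫ x, (torusStrainSqAt (u τ) x + ε) ^ (q / 2) := hle
      _ = C * (M + δ) * ∫ x, (torusStrainSqAt (u τ) x + ε) ^ (q / 2) := by rw [hC]
  -- Step 3: Grönwall for `F_ε` on `J`, then `ε → 0⁺`
  have hcont : ∀ τ ∈ Icc a b, Continuous fun ε : ℝ =>
      ∫ x, (torusStrainSqAt (u τ) x + ε) ^ (q / 2) := fun τ hτ =>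
    continuous_integral_add_rpow (continuous_strainSqAt (hu.isSmooth_slice hτ)) (by linarith)
  have hF_eq : ∀ τ, (∫ x, (torusStrainSqAt (u τ) x + 0) ^ (q / 2)) = torusStrainMoment q (u τ) := by
    intro τ; simp only [add_zero]; rfl
  have hup : ∀ s ∈ Icc a' b', t ≤ s →
      torusStrainMoment q (u s) ≤ Real.exp (C * (M + δ) * (s - t)) * torusStrainMoment q (u t) := by
    intro s hs hts
    have h := le_of_forall_pos_le_of_continuousAt
      (A := fun ε => ∫ x, (torusStrainSqAt (u s) x + ε) ^ (q / 2))
      (B := fun ε => Real.exp (C * (M + δ) * (s - t)) * ∫ x, (torusStrainSqAt (u t) x + ε) ^ (q / 2))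
      (hcont s (hJsub hs)).continuousAt (continuous_const.mul (hcont t ht)).continuousAt
      (fun ε hε _ => exp_bound_of_deriv_le ha'b' (hreg ε hε) htJ hs hts)
    simpa only [hF_eq] using h
  have hdown : ∀ s ∈ Icc a' b', s ≤ t →
      torusStrainMoment q (u t) ≤ Real.exp (C * (M + δ) * (t - s)) * torusStrainMoment q (u s) := by
    intro s hs hst
    have h := le_of_forall_pos_le_of_continuousAt
      (A := fun ε => ∫ x, (torusStrainSqAt (u t) x + ε) ^ (q / 2))
      (B := fun ε => Real.exp (C * (M + δ) * (t - s)) * ∫ x, (torusStrainSqAt (u s) x + ε) ^ (q / 2))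
      (hcont t ht).continuousAt (continuous_const.mul (hcont s (hJsub hs))).continuousAt
      (fun ε hε _ => exp_bound_of_deriv_le ha'b' (hreg ε hε) hs htJ hst)
    simpa only [hF_eq] using h
  -- Step 4: slopes
  exact le_of_exp_bounds hab ht hR hJmem hup hdown

/-- **The dictionary's typed node `StrainMomentCZClosure` (NOGO N8 = K0-FLAGS A5) HOLDS on `T³`:**
`∀ q > 1, ∃ C, StrainMomentRateSupBound q C` at `d = Fin 3`. [ours] -/
theorem strainMomentCZClosure_holds : StrainMomentCZClosure (d := Fin 3) := fun _ hq =>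
  let ⟨C, _, hC⟩ := rateSupBound_of_one_lt hq
  ⟨C, hC⟩

/-- **Generic-shape reading** for every real `q > 1`: `∃ C ≥ 0, FunctionalRateSupBound (torusStrainMoment q) C`
on `T³`. [ours] -/
theorem functionalRateSupBound_of_one_lt {q : ℝ} (hq : 1 < q) :
    ∃ C : ℝ, 0 ≤ C ∧ FunctionalRateSupBound (d := Fin 3) (torusStrainMoment q) C :=
  rateSupBound_of_one_lt hq

/-- **All log rows `ES.absS.q|T_CL|C1|j`, every real `q > 1`, every `j`, every `c ≥ 0` (kernel):**
`∃ C ≥ 0, StrainMomentLogBudget q j C c` on `T³` (N8 + the dictionary's proved domination A5).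
[ours] -/
theorem logBudget_of_one_lt {q : ℝ} (hq : 1 < q) (j : ℕ) {c : ℝ} (hc : 0 ≤ c) :
    ∃ C : ℝ, 0 ≤ C ∧ StrainMomentLogBudget (d := Fin 3) q j C c := by
  obtain ⟨C, hC0, hC⟩ := rateSupBound_of_one_lt hq
  exact ⟨C, hC0, strainMomentLogBudget_of_rateSupBound hC hC0 hc⟩

/-- **Row `ES.absS.q=3/2|T_C|C1` (kernel, control):** `∃ C ≥ 0, StrainMomentRateSupBound (3/2) C` on
`T³` — the singular-weight row, by regularisation. [ours] -/
theorem rateSupBound_three_halves :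
    ∃ C : ℝ, 0 ≤ C ∧ StrainMomentRateSupBound (d := Fin 3) (3 / 2) C :=
  rateSupBound_of_one_lt (by norm_num)

/-- **Rows `ES.absS.q=3/2|T_CL|C1|j` (kernel), every `j`, every `c ≥ 0`.** [ours] -/
theorem logBudget_three_halves (j : ℕ) {c : ℝ} (hc : 0 ≤ c) :
    ∃ C : ℝ, 0 ≤ C ∧ StrainMomentLogBudget (d := Fin 3) (3 / 2) j C c :=
  logBudget_of_one_lt (by norm_num) j hc

end StrainMoment

end Summit.NavierStokesRegularity.FunctionalMining

end
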